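import Literature.Claims.NS.Kampen2015
import HarnessLib

/-!
# C13b `Kampen2015` (arXiv:1502.06699 v3, «Some new consequences of the CKN-theory») — kernel kill of
# the rev-2/3 companion `Step_0Abs`: the printed inference p. 2 TeX l. 87 / p. 3 TeX l. 111 at the
# open-set grain
(cell `ns-claims`, D-0090; KIT by ns-claims-typist-12 g4 (lineage typist of the skeleton), chair GO
2026-08-27T06:22:18Z; ADOPTER of record ns-claims-refuter-7 g2 (or refuter-5 g3 on delegation); FILER a
salvage seat (`--kind refutation --cite Kampen2015CKN`); REF READ-BACK. Skeleton `Literature.Claims.NS.Kampen2015`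
p474485 + rev 2 p505212 (`Step_0Abs`) + rev 3 p505744 (the `μH[1]` clause).)

* `not_Step_0Abs` refutes `Literature.Claims.NS.Kampen2015.Step_0Abs` = the sentence p. 2 TeX l. 87 «Next if
  t_s ∈ ℝ₊ ∖ I is a time of a time slice {t_s} × 𝕋ⁿ related to a possible singularity, then there exists an
  index j ∈ J and an open interval U_j = (t₀, t_s) ⊂ I» (restated p. 3 TeX l. 111 «possible singularities …
  are at the larger endpoint of such an open time interval (as is well-known)»), typed at the grain the
  sentence uses it: for every open `I ⊆ (0,∞)`, dense in `(0,∞)`, of full Lebesgue measure there ((i) p. 1)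
  and with excluded times of zero one-dimensional Hausdorff measure ((ii) p. 2, time axis), every
  `t_s ∈ (0,∞) ∖ I` has an interval `(t₀, t_s) ⊆ I` to its left. WITNESS (left-accumulating excluded
  times): `K = {1} ∪ {1 − 1/(n+1) : n ∈ ℕ}` (countable, compact — a convergent sequence with its limit),
  `I = (0,∞) ∖ K` (open; dense and co-null in `(0,∞)` since `K` is Lebesgue-null; `μH[1] = volume` on `ℝ`),
  `t_s = 1 ∈ (0,∞) ∖ I`: every `(t₀, 1)` contains some `1 − 1/(n+1) ∈ K`, so no `(t₀, 1) ⊆ I`.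
  [refuted-substantive at the typed grain: «open + dense + full measure (+ ℋ¹-null complement)» does not
  make every excluded time the right endpoint of a component — components may accumulate from the left.
  The NS-grain instance `Step_0` (first binder of `claim_of_steps`) is of OPEN strength and is not
  attacked: it follows from regularity of `H¹` slices with weak–strong uniqueness and is not a consequence
  of Leray–Scheffer–CKN (`Literature.Analysis.FluidPDE.scheffer_singular_times`).]

Std axioms only (`propext`, `Classical.choice`, `Quot.sound`; farm-checked by the kit author against the
literal Prop before rev 2 landed and against the tree decl after). No `def … : Prop` with cite tags in
this file (LEAN CONVENTION 8): the witness objects are plain private definitions.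

WHAT THIS IS NOT: not a claim about the Navier–Stokes problem itself (nothing about regularity or blow-up
follows from a statement about open subsets of the time axis); not a claim about any author beyond the
typed locator.
-/

set_option linter.dupNamespace false

namespace Summit.NavierStokesRegularity.NavierStokesRegularity.Theorems.Kampen2015

open Set Filter Topology MeasureTheory
open Literature.Claims.NS.Kampen2015

noncomputable section

/-! ## The witness: excluded times `1 − 1/(n+1)` accumulating at `t_s = 1` from the left -/

/-- The excluded times `a n = 1 − 1/(n+1)` (`a 0 = 0`, `a n ↑ 1`). -/
private def a (n : ℕ) : ℝ := 1 - 1 / ((n : ℝ) + 1)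

/-- `K = {1} ∪ {a n : n ∈ ℕ}` — a countable compact set of times. -/
private def K : Set ℝ := insert 1 (range a)

/-- The open set playing the «regular times»: `I = (0,∞) ∖ K`. -/
private def I : Set ℝ := Ioi 0 \ K

/-- `a n → 1` as `n → ∞`. -/
private theorem tendsto_a : Tendsto a atTop (𝓝 1) := by
  have h := (tendsto_one_div_add_atTop_nhds_zero_nat (𝕜 := ℝ))
  have : Tendsto (fun n : ℕ => (1 : ℝ) - 1 / ((n : ℝ) + 1)) atTop (𝓝 (1 - 0)) :=
    tendsto_const_nhds.sub h
  rw [sub_zero] at this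
  exact this

/-- Every excluded time `a n` lies strictly below `1`. -/
private theorem a_lt_one (n : ℕ) : a n < 1 := by
  have : (0 : ℝ) < 1 / ((n : ℝ) + 1) := by positivity
  simp only [a]; linarith

/-- `K` is closed (compact: a convergent sequence together with its limit). -/
private theorem isClosed_K : IsClosed K := (tendsto_a.isCompact_insert_range).isClosed

/-- `K` is countable, hence Lebesgue-null. -/
private theorem volume_K : volume K = 0 := ((countable_range a).insert 1).measure_zero volume

/-- `I = (0,∞) ∖ K` is open. -/
private theorem isOpen_I : IsOpen I := isOpen_Ioi.sdiff isClosed_K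

/-- `I ⊆ (0,∞)`. -/
private theorem I_subset : I ⊆ Ioi 0 := fun _ h => h.1

/-- (i): the excluded times `(0,∞) ∖ I ⊆ K` are Lebesgue-null. -/
private theorem compl_null : volume (Ioi 0 \ I) = 0 := by
  refine measure_mono_null (fun t ht => ?_) volume_K
  by_contra hK
  exact ht.2 ⟨ht.1, hK⟩

/-- (ii) on the time axis: the excluded times have zero one-dimensional Hausdorff measure. -/
private theorem compl_hausdorff_null : μH[1] (Ioi (0 : ℝ) \ I) = 0 := by
  rw [MeasureTheory.hausdorffMeasure_real]; exact compl_null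

/-- (i): `I` is dense in `(0,∞)` — a neighbourhood of `t > 0` inside `(0,∞)` has positive measure, `K` has none. -/
private theorem dense_I : Ioi (0 : ℝ) ⊆ closure I := by
  intro t ht
  rw [mem_closure_iff_nhds]
  intro U hU
  have hU' : U ∩ Ioi 0 ∈ 𝓝 t := inter_mem hU (isOpen_Ioi.mem_nhds ht)
  have hpos : 0 < volume (U ∩ Ioi 0) := Measure.measure_pos_of_mem_nhds volume hU'
  by_contra hempty
  have hsub : U ∩ Ioi 0 ⊆ K := by
    intro s hs
    by_contra hsK
    exact hempty ⟨s, hs.1, hs.2, hsK⟩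
  exact hpos.ne' (measure_mono_null hsub volume_K)

/-- The excluded time `t_s = 1` lies in `(0,∞) ∖ I`. -/
private theorem one_mem : (1 : ℝ) ∈ Ioi 0 \ I :=
  ⟨mem_Ioi.mpr one_pos, fun h => h.2 (mem_insert 1 _)⟩

/-- No interval `(t₀, 1)` avoids `K`: the excluded times `a n → 1⁻` enter it. -/
private theorem no_left_interval {t₀ : ℝ} (ht₀ : t₀ < 1) : ¬ Ioo t₀ 1 ⊆ I := by
  intro hsub
  have hev : ∀ᶠ n in atTop, a n ∈ Ioo t₀ 2 := tendsto_a (Ioo_mem_nhds ht₀ (by norm_num))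
  obtain ⟨n, hn⟩ := hev.exists
  exact (hsub ⟨hn.1, a_lt_one n⟩).2 (mem_insert_of_mem 1 (mem_range_self n))

/-! ## The kill -/

/-- **Refutes `Kampen2015.Step_0Abs`** = p. 2 TeX l. 87 / p. 3 TeX l. 111 at the open-set grain
[refuted-substantive]: with `I = (0,∞) ∖ ({1} ∪ {1 − 1/(n+1)})` — open, dense and co-null in `(0,∞)`,
excluded times `ℋ¹`-null — the excluded time `t_s = 1` is NOT the right endpoint of any interval
`(t₀, 1) ⊆ I`. Every printed property (i)–(ii) of `I` is among the hypotheses discharged.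
[cite: Kampen2015CKN, (i)–(ii) pp. 1–2 (TeX l. 64–75); TeX l. 87 p. 2; TeX l. 111 p. 3]
WHAT THIS IS NOT: not a claim about NS regularity or blow-up; not a claim about any author beyond the
typed locator. -/
theorem not_Step_0Abs : ¬ Literature.Claims.NS.Kampen2015.Step_0Abs := by
  intro h
  obtain ⟨t₀, ht₀, hsub⟩ := h I isOpen_I I_subset dense_I compl_null compl_hausdorff_null 1 one_mem
  exact no_left_interval ht₀ hsub

/-- Type-exactness probe (MAP-SCHEMA §1g): the headline's type is literally `¬ Step_0Abs`. -/
example : ¬ Literature.Claims.NS.Kampen2015.Step_0Abs := not_Step_0Abs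

end

end Summit.NavierStokesRegularity.NavierStokesRegularity.Theorems.Kampen2015
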